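import Mathlib
import HarnessLib.Audit
import Summits.PneNP.PneNP.Theorems.PstarCrossCaseTEq

/-!
# The blind free CROSS gate, regime T (node N3): the (EQ) case is reduced to several real chords with at most one private tree edge (O2 / E1; prover-1 g23)

FRONTIER range-avoidance ladder, rung F-N3 (`stmt-PneNP-19007`), cell `pnp-ideate`; restricted-model proof complexity — nothing here bears on `P` versus `NP`.

One citable statement of what `PstarCrossCaseTEq.crossCaseT_eq_single` (a single real chord: `#J₀ ≤ 5`) and
`PstarCrossCaseTEqPriv.caseT_eq_two_priv_false` (a second real chord and two private tree edges: contradiction) leave of the (EQ) row `q_m = u_{e₁}` of node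
N3 (`PstarCrossNodes.CrossCaseT`):

* **`crossCaseT_eq_reduction`** — in regime T with `q_m = u_{e₁}` for a real chord `e₁`: EITHER `#J₀ ≤ 5`, OR there is a second real chord and the core has
  at most one private tree edge (`PstarCrossCorner.PrivEdge`).  In the latter case the cross budget only gives `#(J₀ ∖ N) + 1 ≤ #E + 2`
  (`PstarCrossBudget.cross_budget`); closing it is the remaining work on the (EQ) row.
-/

set_option linter.dupNamespace false -- `Summit.PneNP.PneNP.…`: summit = sub-problem name (D-0017 single-conjunct layout)

open Finset Literature.Computability.Complexity
open Summit.PneNP.PneNP.Theorems.PstarTyped (Typed)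
open Summit.PneNP.PneNP.Theorems.PstarSALevel (BoundaryExpanding SimpleOverlap)
open Summit.PneNP.PneNP.Theorems.PstarReadSumset (V2)
open Summit.PneNP.PneNP.Theorems.PstarChordSystem (ChordSystem)
open Summit.PneNP.PneNP.Theorems.PstarChordBridge
open Summit.PneNP.PneNP.Theorems.PstarChordBridgeBasis (qDir)
open Summit.PneNP.PneNP.Theorems.PstarCrossData (CrossData)
open Summit.PneNP.PneNP.Theorems.PstarCrossSystem
open Summit.PneNP.PneNP.Theorems.PstarCrossCorner (PrivEdge)
open Summit.PneNP.PneNP.Theorems.PstarCrossCaseTEq (crossCaseT_eq_single)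
open Summit.PneNP.PneNP.Theorems.PstarCrossCaseTEqPriv (caseT_eq_two_priv_false)

namespace Summit.PneNP.PneNP.Theorems.PstarCrossCaseTEqReduction

variable {n m : ℕ}

/-- **The (EQ) row of node N3, reduced.**  See the module docstring. -/
theorem crossCaseT_eq_reduction (I : LocalMap 4 n m) {r : ℕ} {B : BridgeData n m} {e_p e_q g₀ : Fin m}
    (hI : I.IsPure xorAndPred) (hT : Typed I) (hS : SimpleOverlap I) (hB : BoundaryExpanding r I)
    (hD : CrossData I r B e_p e_q g₀) {mv : V2} (hmvT : mv = (0, 1) ∨ mv = (1, 1))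
    (hline : ∀ e ∈ (B.N.erase e_q).erase e_p,
      (((sys I B).vsys e_p e_q).ρ e 0 = 0 ∨ ((sys I B).vsys e_p e_q).ρ e 0 = mv) ∧
      (((sys I B).vsys e_p e_q).ρ' e 0 = 0 ∨ ((sys I B).vsys e_p e_q).ρ' e 0 = mv))
    (hread : ∀ e ∈ (B.N.erase e_q).erase e_p, ((sys I B).vsys e_p e_q).ρ e 0 ≠ 0 ∨ ((sys I B).vsys e_p e_q).ρ' e 0 ≠ 0)
    {e₁ : Fin m} (he₁ : e₁ ∈ (B.N.erase e_q).erase e_p) (hq : ∀ x, qDir I B mv x = (sys I B).u e₁ x) :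
    B.J₀.card ≤ 5 ∨
    ((∃ e₂ ∈ (B.N.erase e_q).erase e_p, e₂ ≠ e₁) ∧ ∀ π₁ π₂, PrivEdge I B π₁ → PrivEdge I B π₂ → π₁ = π₂) := by
  by_cases hE : ∃ e₂ ∈ (B.N.erase e_q).erase e_p, e₂ ≠ e₁
  · refine Or.inr ⟨hE, fun π₁ π₂ hπ₁ hπ₂ => ?_⟩
    obtain ⟨e₂, he₂, hne⟩ := hE
    by_contra h12
    exact caseT_eq_two_priv_false I hI hT hS hB hD hmvT hline hread he₁ hq he₂ hne hπ₁ hπ₂ h12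
  · push Not at hE
    have hsingle : (B.N.erase e_q).erase e_p = {e₁} :=
      eq_singleton_iff_unique_mem.2 ⟨he₁, fun e he => hE e he⟩
    exact Or.inl (crossCaseT_eq_single I hI hT hS hB hD hmvT hline hread hsingle hq)

end Summit.PneNP.PneNP.Theorems.PstarCrossCaseTEqReduction
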